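import Summits.QuantumFields.YangMills.Theorems.BalabanUVNodesN15CurvedGluingCubeDressedGeneralRemainderRow
import Summits.QuantumFields.YangMills.Theorems.BalabanUVNodesN15CurvedGluingCubeDressedGeneralCommutatorDefect
import HarnessLib

/-!
# Route «BalabanUVNodes» (cluster K4 «SpineRates»), Track-A DAG node N15 = NE2, BACKGROUND LAYER — THE η-DEFECT OF THE REMAINDER's COMMUTATOR ROW FOR THE GENERAL DRESSED CUBE (FILE 58's
# `hDK` shape), PIECES: the flat half's defect BY NAME (dag-n15-c FILE 46 §3 on files 24∕25's two-sided defects), the nonlocal flat summand's (a FILE 57-style defect Leibniz), and the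
# concrete jets' defect adapters for the dressed perturbation's half (file 28); the assembly is the sequel `…RemainderRowDefectAssembly`

Cell `pub-ymgap`, seat `pub-ymgap-dag-n15-w4` (WIDTH SEAT 4 on node N15; the sequel of `…RemainderRow` announced in its CLAIM-1∕INTENT-1, dag-n15-w3 g3's located (h) «+ its `hKc`∕`hDK`
assembly»).  `bears_on: R4∕N15 · K3⁷ SpineGivenEndpointR13SepCoPH (stmt-QuantumFields-20544)`.  Filed `--kind proof --supports stmt-QuantumFields-20544 --as helper` — COUNT-NEUTRAL.  Theorems
only; 0 `sorry`.  Imports BY NAME this seat's `…RemainderRow` (`commOp_sub_left`, `hasMaj_jetRem_diagK`, `abs_jetReading_sub_le`, `hasMaj_commOp_lapOp_dressedV_loc₂`; through it files 23–26,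
FILES 46∕56∕57) and dag-n15-w3 file 28 `…CubeDressedGeneralCommutatorDefect` (`hasMaj_idef_twistedComm`, `hasMaj_idef_commOp_dressedPert_comp`); nothing in the tree is modified, nothing of
FILES 43–69 or files 12–28 re-declared.

WHY.  FILE 58 `gluedLetters_of_cubeRows_in` wants, next to `hKc`, the two-grid defect row `hDK : 𝔇([Δ′, M_{h′_i}]∘G′_i, [Δ, M_{h_i}]∘G_i) ≤ 1_{S_i}(y′)·r₀e^{−δd}`.  For the general dressed
cube with its own operator `Σ∇*∇ + W + N − 𝒱` the defect splits like the row: the flat local half is FILE 46 §3 (`hasMaj_idef_commOp_lapOp_comp`) on the dressed entries' two-sided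
defects (file 24 `hasMaj_idef_dressedV_loc₂`, file 25 `hasMaj_idef_projO_dressedV_loc₂` read through `projO_some_dressedV` at both grids) with the partition's fine letters `c₁ c₂` and fits
`o₁ o₂`; the nonlocal summand's is the Leibniz split `𝔇([N′,M_{h′}]X′, [N,M_h]X) = [N′,M_{h′}]∘𝔇(X′,X) + 𝔇([N′,M_{h′}],[N,M_h])∘X` against FILE 56's letters; the perturbation's is file 28,
whose letter-level inputs are discharged here for the CONCRETE forward∕backward jets: the twisted commutator `V̂′M_{a′} − M_{h′}V̂′` by FILE 56 `hasMaj_comm_nonlocal` at the fine grid, its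
defect by file 28 `hasMaj_idef_twistedComm`, the pair and its defect by files 23∕24, the jets' Leibniz remainders by `hasMaj_jetRem_diagK` and §1 below.
* §1 ★ `hasMaj_idef_jetRem_diagK` (`𝔇(D′_{h′}, D_h) ≤ diagK o₁` from the fits `|∇′^±h′ − (∇^±h)∘π| ≤ o₁`), ★ `abs_jetReading_fit_le` (the jet readings' fit `|a′ − a∘π̂| ≤ oo + c₁∕n′ + c₁∕n` from
  `|h′ − h∘π| ≤ oo` and `|∇^±h|, |∇′^±h′| ≤ c₁`, `n, n′ > 0`);
* §2 ★★ `hasMaj_idef_commOp_lapOp_dressedV_loc₂` — the flat half's defect, two-sided: `≤ 1_S1_S·(|J|(c₂m + o₂β′ + 2(c₁m + o₁β′)) + r_W)·e^{−ρ₂d}` with `β′ = β(1 − βRc_r²)⁻¹` and `m` = files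
  24∕25's dressed-entry defect constant;
* §3 ★ `hasMaj_idef_commOp_comp_in` — generic: `𝔇([N′,M_{h′}]∘G′, [N,M_h]∘G) ≤ 1_S(y′)·(c_N·m + r_N·β)c_r·e^{−ρd}` from the letters `[N′,M_{h′}] ≤ c_Ne^{−ρ_Nd}`, `𝔇([N′,M_{h′}],[N,M_h]) ≤ r_Ne^{−ρ_Nd}`
  and the cube's two-sided `G ≤ 1_S1_S·βe^{−δd}`, `𝔇(G′,G) ≤ 1_S1_S·me^{−δd}`;
The assembly of §2, §3 and dag-n15-w3 file 28 into FILE 58's `hDK` shape (★★★ `hasMaj_idef_commOp_cubeOp_dressedV_in`) is the sequel `…RemainderRowDefectAssembly` (400-line budget).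

HONEST FRAMING ∕ LIMITS.  Finite-dimensional operator algebra + block-majorant bookkeeping over DISPLAYED letters; [B6] (2.91)–(2.92) p. 239, (2.133)–(2.134) p. 247, [B5] (1.120)–(1.128)
pp. 37–38, [B9] (3.62)–(3.65) pp. 402–403, (3.76)–(3.77) pp. 405–406, Thm 3.14 pp. 426–427 (difference template) = SHAPES ∕ MECHANISM — nothing of [B5]∕[B6]∕[B9] asserted.  NE2⁺ NOT PRINTED,
NOT proved; N15 NOT discharged; counts of record UNMOVED (typed 28∕28 · discharged 5∕27); no summit statement is proved here; one finite 𝕋⁴ at fixed ε — NOT infinite volume, NOT OS on ℝ⁴, NOT a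
mass gap, NOT Clay; R4 closes the conditional finite-𝕋⁴ rung `BalabanLadder.UV` only.  Restate-immune (no Theses import).
-/

set_option autoImplicit false

noncomputable section
open scoped BigOperators
open Finset

namespace Summit.QuantumFields.YangMills.BalabanUVNodes.N15.CurvedSpecies

open Literature.MathematicalPhysics.QuantumFieldTheory.Balaban1983to89
open Literature.MathematicalPhysics.QuantumFieldTheory.Balaban1983to89.B11SectG (BlockNorm HasMaj RowSum hasMaj_zero hasMaj_comp_exp)
open Literature.MathematicalPhysics.QuantumFieldTheory.Balaban1983to89.B6RandomWalk (Triangle254)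
open Literature.MathematicalPhysics.QuantumFieldTheory.Balaban1983to89.T4EtaRateDefect (idef idef_apply idef_comp idef_add idef_sub)
open Literature.MathematicalPhysics.QuantumFieldTheory.Balaban1983to89.T4EtaRateCoeffDefect (pull pull_apply diagK diagK_nonneg hasMaj_mulOp hasMaj_idef_mulOp)
open Literature.MathematicalPhysics.QuantumFieldTheory.Balaban1983to89.B6Prop26Gluing (mulOp mulOp_apply ind ind_nonneg ind_le_one ind_of_mem)
open Summit.QuantumFields.YangMills.BalabanUVNodes.N15.MatrixSpecies (liftBlk liftMap liftEquiv liftEquiv_apply liftEquiv_symm_apply)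
open Summit.QuantumFields.YangMills.BalabanUVNodes.N15.BackgroundModel (kappa_ofBlocks)
open Summit.QuantumFields.YangMills.BalabanUVNodes.N15.BackgroundLayer (fgrad bgrad fgradAdj fgrad_apply bgrad_apply stack projO blkPair liftPair hasMaj_stack hasMaj_projO_comp idef_stack
  bgPropV projO_none_comp_stack projO_some_comp_stack)
open Summit.QuantumFields.YangMills.BalabanUVNodes.N15.Gluing (commOp lapOp commOp_add_left hasMaj_idef_commOp_lapOp_comp hasMaj_comm_nonlocal hasMaj_comp_exp_in)

/-! ## §1 The concrete jets' defect adapters -/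

section Jet

variable {X X' ι J : Type} [Fintype X] [Fintype X'] [DecidableEq X] [DecidableEq X'] [Fintype ι] [DecidableEq ι] [Fintype J] [DecidableEq J] {g : B6.Geometry}
  (blk : X → g.Site) (π : X' → X) (τ : J → X ≃ X) (τ' : J → X' ≃ X') (n n' : ℝ)

omit [DecidableEq X] [DecidableEq X'] [DecidableEq ι] [DecidableEq J] in
/-- ★ **THE DEFECT OF THE JETS' LEIBNIZ REMAINDERS IS DIAGONAL**: `𝔇(D′_{h′}, D_h) ≤ diagK o₁` for `D_h = (0, (M_{∇⁺_μh})_μ, (M_{∇⁻_μh})_μ)` at both grids, from the fits of the partition's first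
quotients `|∇′^±_μh′ − (∇^±_μh)∘π| ≤ o₁` — file 28's `hDDh` for the concrete forward∕backward jets. [cite: Balaban1985BackgroundPropagators, Thm 3.14 pp.426–427 (difference template); Balaban1984PropagatorsII, p.239] -/
theorem hasMaj_idef_jetRem_diagK {h : X × ι → ℝ} {h' : X' × ι → ℝ} {o₁ : ℝ} (ho₁ : 0 ≤ o₁)
    (hf1 : ∀ μ p', |fgrad n' (liftEquiv (τ' μ) ι) h' p' - fgrad n (liftEquiv (τ μ) ι) h (liftMap π ι p')| ≤ o₁)
    (hf1b : ∀ μ p', |bgrad n' (liftEquiv (τ' μ) ι) h' p' - bgrad n (liftEquiv (τ μ) ι) h (liftMap π ι p')| ≤ o₁) :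
    HasMaj (BlockNorm.ofBlocks g (liftBlk blk ι)) (BlockNorm.ofBlocks g (blkPair (liftBlk (blk ∘ π) ι)))
      (idef (pull (liftMap π ι)) (pull (liftPair (liftMap π ι)))
        (stack 0 (fun j : J ⊕ J => Sum.elim (fun μ => mulOp (fgrad n' (liftEquiv (τ' μ) ι) h')) (fun μ => mulOp (bgrad n' (liftEquiv (τ' μ) ι) h')) j))
        (stack 0 (fun j : J ⊕ J => Sum.elim (fun μ => mulOp (fgrad n (liftEquiv (τ μ) ι) h)) (fun μ => mulOp (bgrad n (liftEquiv (τ μ) ι) h)) j)))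
      (diagK fun _ => o₁) := by
  rw [idef_stack]
  refine hasMaj_stack (liftBlk (blk ∘ π) ι) (diagK_nonneg fun _ => ho₁) ?_ fun j => ?_
  · have h0 : idef (pull (liftMap π ι)) (pull (liftMap π ι)) (0 : (X' × ι → ℝ) →ₗ[ℝ] (X' × ι → ℝ)) (0 : (X × ι → ℝ) →ₗ[ℝ] (X × ι → ℝ)) = 0 := by
      rw [idef, LinearMap.zero_comp, LinearMap.comp_zero, sub_zero]
    rw [h0]
    exact (hasMaj_zero _ _).mono fun y y' => diagK_nonneg (fun _ => ho₁) y y'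
  · rcases j with μ | μ
    · exact hasMaj_idef_mulOp (liftBlk blk ι) (liftMap π ι) (o := fun _ => o₁) (fun _ => ho₁) (hf1 μ)
    · exact hasMaj_idef_mulOp (liftBlk blk ι) (liftMap π ι) (o := fun _ => o₁) (fun _ => ho₁) (hf1b μ)

omit [Fintype X] [Fintype X'] [DecidableEq X] [DecidableEq X'] [Fintype ι] [DecidableEq ι] [Fintype J] [DecidableEq J] in
/-- ★ **THE FIT OF THE JETS' READINGS OF THE PARTITION**: from `|h′ − h∘π| ≤ oo` and the first-quotient letters `|∇^±_μh| ≤ c₁` (spacing `n > 0`), `|∇′^±_μh′| ≤ c₁` (spacing `n′ > 0`) the fine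
reading `a′(p′, ±μ) = h′(τ′_μ^{±1}p′)` is within `oo + c₁∕n′ + c₁∕n` of the coarse reading at the projected point `a(π̂p′, ±μ) = h(τ_μ^{±1}πp′)` — file 28's `hfa` for the concrete jets (the
two steps differ, each moves `h` by at most `c₁∕spacing`). [cite: Balaban1984PropagatorsII, p.229 («|∂h_□| ≤ O(1)(ML^jη)⁻¹»: shape); Balaban1985BackgroundPropagators, Thm 3.14 pp.426–427 (template)] -/
theorem abs_jetReading_fit_le {h : X × ι → ℝ} {h' : X' × ι → ℝ} {c₁ oo : ℝ} (hn : 0 < n) (hn' : 0 < n') (hc₁ : 0 ≤ c₁)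
    (hh1 : ∀ μ p, |fgrad n (liftEquiv (τ μ) ι) h p| ≤ c₁) (hh1b : ∀ μ p, |bgrad n (liftEquiv (τ μ) ι) h p| ≤ c₁)
    (hh1' : ∀ μ p', |fgrad n' (liftEquiv (τ' μ) ι) h' p'| ≤ c₁) (hh1b' : ∀ μ p', |bgrad n' (liftEquiv (τ' μ) ι) h' p'| ≤ c₁) (hfh : ∀ p', |h' p' - h (liftMap π ι p')| ≤ oo)
    (q' : (X' × ι) × Option (J ⊕ J)) :
    |Option.elim q'.2 (h' q'.1) (fun j => Sum.elim (fun μ => h' (liftEquiv (τ' μ) ι q'.1)) (fun μ => h' ((liftEquiv (τ' μ) ι).symm q'.1)) j) -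
        Option.elim (liftPair (liftMap π ι) q').2 (h (liftPair (liftMap π ι) q').1)
          (fun j => Sum.elim (fun μ => h (liftEquiv (τ μ) ι (liftPair (liftMap π ι) q').1)) (fun μ => h ((liftEquiv (τ μ) ι).symm (liftPair (liftMap π ι) q').1)) j)| ≤
      oo + c₁ / n' + c₁ / n := by
  have hcn : 0 ≤ c₁ / n := div_nonneg hc₁ hn.le
  have hcn' : 0 ≤ c₁ / n' := div_nonneg hc₁ hn'.le
  -- one step moves `h` by at most `c₁ ∕ spacing`
  have stepF : ∀ μ p, |h (liftEquiv (τ μ) ι p) - h p| ≤ c₁ / n := fun μ p => by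
    rw [le_div_iff₀ hn]
    have := hh1 μ p
    rw [fgrad_apply, abs_mul, abs_of_pos hn] at this
    linarith [mul_comm n (|h (liftEquiv (τ μ) ι p) - h p|)]
  have stepB : ∀ μ p, |h p - h ((liftEquiv (τ μ) ι).symm p)| ≤ c₁ / n := fun μ p => by
    rw [le_div_iff₀ hn]
    have := hh1b μ p
    rw [bgrad_apply, abs_mul, abs_of_pos hn] at this
    linarith [mul_comm n (|h p - h ((liftEquiv (τ μ) ι).symm p)|)]
  have stepF' : ∀ μ p', |h' (liftEquiv (τ' μ) ι p') - h' p'| ≤ c₁ / n' := fun μ p' => by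
    rw [le_div_iff₀ hn']
    have := hh1' μ p'
    rw [fgrad_apply, abs_mul, abs_of_pos hn'] at this
    linarith [mul_comm n' (|h' (liftEquiv (τ' μ) ι p') - h' p'|)]
  have stepB' : ∀ μ p', |h' p' - h' ((liftEquiv (τ' μ) ι).symm p')| ≤ c₁ / n' := fun μ p' => by
    rw [le_div_iff₀ hn']
    have := hh1b' μ p'
    rw [bgrad_apply, abs_mul, abs_of_pos hn'] at this
    linarith [mul_comm n' (|h' p' - h' ((liftEquiv (τ' μ) ι).symm p')|)]
  obtain ⟨p', _ | j⟩ := q'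
  · calc |h' p' - h (liftMap π ι p')| ≤ oo := hfh p'
      _ ≤ oo + c₁ / n' + c₁ / n := by linarith
  · rcases j with μ | μ
    · show |h' (liftEquiv (τ' μ) ι p') - h (liftEquiv (τ μ) ι (liftMap π ι p'))| ≤ oo + c₁ / n' + c₁ / n
      have e1 := stepF' μ p'
      have e2 := hfh p'
      have e3 := stepF μ (liftMap π ι p')
      calc |h' (liftEquiv (τ' μ) ι p') - h (liftEquiv (τ μ) ι (liftMap π ι p'))|
          = |(h' (liftEquiv (τ' μ) ι p') - h' p') + (h' p' - h (liftMap π ι p')) - (h (liftEquiv (τ μ) ι (liftMap π ι p')) - h (liftMap π ι p'))| := by ring_nf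
        _ ≤ |(h' (liftEquiv (τ' μ) ι p') - h' p') + (h' p' - h (liftMap π ι p'))| + |h (liftEquiv (τ μ) ι (liftMap π ι p')) - h (liftMap π ι p')| := abs_sub _ _
        _ ≤ |h' (liftEquiv (τ' μ) ι p') - h' p'| + |h' p' - h (liftMap π ι p')| + |h (liftEquiv (τ μ) ι (liftMap π ι p')) - h (liftMap π ι p')| := by
            linarith [abs_add_le (h' (liftEquiv (τ' μ) ι p') - h' p') (h' p' - h (liftMap π ι p'))]
        _ ≤ c₁ / n' + oo + c₁ / n := add_le_add (add_le_add e1 e2) e3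
        _ = oo + c₁ / n' + c₁ / n := by ring
    · show |h' ((liftEquiv (τ' μ) ι).symm p') - h ((liftEquiv (τ μ) ι).symm (liftMap π ι p'))| ≤ oo + c₁ / n' + c₁ / n
      have e1 := stepB' μ p'
      have e2 := hfh p'
      have e3 := stepB μ (liftMap π ι p')
      calc |h' ((liftEquiv (τ' μ) ι).symm p') - h ((liftEquiv (τ μ) ι).symm (liftMap π ι p'))|
          = |(h (liftMap π ι p') - h ((liftEquiv (τ μ) ι).symm (liftMap π ι p'))) + (h' p' - h (liftMap π ι p')) - (h' p' - h' ((liftEquiv (τ' μ) ι).symm p'))| := by ring_nf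
        _ ≤ |(h (liftMap π ι p') - h ((liftEquiv (τ μ) ι).symm (liftMap π ι p'))) + (h' p' - h (liftMap π ι p'))| + |h' p' - h' ((liftEquiv (τ' μ) ι).symm p')| := abs_sub _ _
        _ ≤ |h (liftMap π ι p') - h ((liftEquiv (τ μ) ι).symm (liftMap π ι p'))| + |h' p' - h (liftMap π ι p')| + |h' p' - h' ((liftEquiv (τ' μ) ι).symm p')| := by
            linarith [abs_add_le (h (liftMap π ι p') - h ((liftEquiv (τ μ) ι).symm (liftMap π ι p'))) (h' p' - h (liftMap π ι p'))]
        _ ≤ c₁ / n + oo + c₁ / n' := add_le_add (add_le_add e3 e2) e1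
        _ = oo + c₁ / n' + c₁ / n := by ring

end Jet

/-! ## §2 The flat half's η-defect, two-sided, for the general dressed cube -/

section Flat

variable {X X' ι J : Type} [Fintype X] [Fintype X'] [DecidableEq X] [DecidableEq X'] [Fintype ι] [DecidableEq ι] [Fintype J] [DecidableEq J] {g : B6.Geometry}
  (blk : X → g.Site) (π : X' → X) (τ : J → X ≃ X) (τ' : J → X' ≃ X') (n n' : ℝ) {σ cr : ℝ}
  {G₀ : (X × ι → ℝ) →ₗ[ℝ] (X × ι → ℝ)} {D Dq : J ⊕ J → (X × ι → ℝ) →ₗ[ℝ] (X × ι → ℝ)} {V : ((X × ι) × Option (J ⊕ J) → ℝ) →ₗ[ℝ] (X × ι → ℝ)}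
  {G₀' : (X' × ι → ℝ) →ₗ[ℝ] (X' × ι → ℝ)} {D' Dq' : J ⊕ J → (X' × ι → ℝ) →ₗ[ℝ] (X' × ι → ℝ)} {V' : ((X' × ι) × Option (J ⊕ J) → ℝ) →ₗ[ℝ] (X' × ι → ℝ)}

/-- ★★ **THE η-DEFECT OF THE FLAT HALF, TWO-SIDED**: the flat cubes' data at both grids (`G₀, D_j, G₀′, D′_j ≤ βe^{−δd}`, pair defects `𝔇(G₀′,G₀), 𝔇(D′_j,D_j) ≤ m_Ge^{−δd}`, cut-offs over `S` at
both grids, `D_j = Dq_j∘G₀` for the forward∕backward jets), the perturbations `V̂, V̂′ ≤ Re^{−δ_Vd}` with `𝔇(V̂′,V̂) ≤ oe^{−δ_Vd}`, `βRc_r² < 1`, the FINE partition's `|∇′^±h′| ≤ c₁`,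
`|∇′*∇′h′| ≤ c₂`, the fits `|∇′^±h′ − (∇^±h)∘π| ≤ o₁`, `|∇′*∇′h′ − (∇*∇h)∘π| ≤ o₂`, and the `W`-defect row `r_W` (displayed, FILE 46 §3's `hDW` shape) ⟹
`𝔇([Σ∇′*∇′ + W′, M_{h′}]∘X′, [Σ∇*∇ + W, M_h]∘X) ≤ 1_S(y)1_S(y′)·(|J|(c₂m + o₂β′ + 2(c₁m + o₁β′)) + r_W)·e^{−ρ₂d}`, `β′ = β(1 − βRc_r²)⁻¹`, `m` = file 25's defect constant — dag-n15-c FILE 46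
`hasMaj_idef_commOp_lapOp_comp` on file 23∕25's two-sided entries and file 25's two-sided defects of every component.
[cite: Balaban1984PropagatorsII, (2.92) p.239, (2.133)–(2.134) p.247 (shapes); Balaban1985BackgroundPropagators, Thm 3.14 pp.426–427 (difference template)] -/
theorem hasMaj_idef_commOp_lapOp_dressedV_loc₂ (htri : Triangle254 g) (hd : ∀ a b : g.Site, 0 ≤ g.dist a b) (hrow : RowSum g σ cr) (hσ : 0 ≤ σ) (hcr : 0 ≤ cr)
    {ρ₁ ρ₂ δ δV β R o mG c₁ c₂ o₁ o₂ rW : ℝ} (hβ : 0 ≤ β) (hR : 0 ≤ R) (ho : 0 ≤ o) (hmG : 0 ≤ mG) (hσρ : σ ≤ ρ₁) (hρ₁V : ρ₁ ≤ δV) (hρ₁G : ρ₁ + σ ≤ δ) (hρ₂ : 0 ≤ ρ₂)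
    (hρ₂₁ : ρ₂ + σ ≤ ρ₁) (hc₁ : 0 ≤ c₁) (hc₂ : 0 ≤ c₂) (ho₁ : 0 ≤ o₁) (ho₂ : 0 ≤ o₂)
    (hDqf : ∀ μ, Dq (Sum.inl μ) = fgrad n (liftEquiv (τ μ) ι)) (hDqb : ∀ μ, Dq (Sum.inr μ) = bgrad n (liftEquiv (τ μ) ι))
    (hDqf' : ∀ μ, Dq' (Sum.inl μ) = fgrad n' (liftEquiv (τ' μ) ι)) (hDqb' : ∀ μ, Dq' (Sum.inr μ) = bgrad n' (liftEquiv (τ' μ) ι))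
    (hDq : ∀ j, D j = Dq j ∘ₗ G₀) (hDq' : ∀ j, D' j = Dq' j ∘ₗ G₀')
    {S : Set g.Site} {χX ψX : X → ℝ} {χX' ψX' : X' → ℝ} (hSχ : ∀ x, χX x ≠ 0 → blk x ∈ S) (hSψ : ∀ x, ψX x ≠ 0 → blk x ∈ S) (hSχ' : ∀ x', χX' x' ≠ 0 → blk (π x') ∈ S)
    (hSψ' : ∀ x', ψX' x' ≠ 0 → blk (π x') ∈ S) (hGχ : mulOp (fun p : X × ι => χX p.1) ∘ₗ G₀ = G₀) (hDχ : ∀ j, mulOp (fun p : X × ι => χX p.1) ∘ₗ D j = D j)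
    (hGψ : G₀ ∘ₗ mulOp (fun p : X × ι => ψX p.1) = G₀) (hGχ' : mulOp (fun p : X' × ι => χX' p.1) ∘ₗ G₀' = G₀') (hDχ' : ∀ j, mulOp (fun p : X' × ι => χX' p.1) ∘ₗ D' j = D' j)
    (hGψ' : G₀' ∘ₗ mulOp (fun p : X' × ι => ψX' p.1) = G₀') {W : (X × ι → ℝ) →ₗ[ℝ] (X × ι → ℝ)} {W' : (X' × ι → ℝ) →ₗ[ℝ] (X' × ι → ℝ)} {h : X × ι → ℝ} {h' : X' × ι → ℝ}
    (hh1' : ∀ μ p', |fgrad n' (liftEquiv (τ' μ) ι) h' p'| ≤ c₁) (hh1b' : ∀ μ p', |bgrad n' (liftEquiv (τ' μ) ι) h' p'| ≤ c₁)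
    (hh2' : ∀ μ p', |fgradAdj n' (liftEquiv (τ' μ) ι) (fgrad n' (liftEquiv (τ' μ) ι) h') p'| ≤ c₂)
    (hf1 : ∀ μ p', |fgrad n' (liftEquiv (τ' μ) ι) h' p' - fgrad n (liftEquiv (τ μ) ι) h (liftMap π ι p')| ≤ o₁)
    (hf1b : ∀ μ p', |bgrad n' (liftEquiv (τ' μ) ι) h' p' - bgrad n (liftEquiv (τ μ) ι) h (liftMap π ι p')| ≤ o₁)
    (hf2 : ∀ μ p', |fgradAdj n' (liftEquiv (τ' μ) ι) (fgrad n' (liftEquiv (τ' μ) ι) h') p' - fgradAdj n (liftEquiv (τ μ) ι) (fgrad n (liftEquiv (τ μ) ι) h) (liftMap π ι p')| ≤ o₂)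
    (hG : HasMaj (BlockNorm.ofBlocks g (liftBlk blk ι)) (BlockNorm.ofBlocks g (liftBlk blk ι)) G₀ (fun y y' => β * Real.exp (-(δ * g.dist y y'))))
    (hD : ∀ j, HasMaj (BlockNorm.ofBlocks g (liftBlk blk ι)) (BlockNorm.ofBlocks g (liftBlk blk ι)) (D j) (fun y y' => β * Real.exp (-(δ * g.dist y y'))))
    (hG' : HasMaj (BlockNorm.ofBlocks g (liftBlk (blk ∘ π) ι)) (BlockNorm.ofBlocks g (liftBlk (blk ∘ π) ι)) G₀' (fun y y' => β * Real.exp (-(δ * g.dist y y'))))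
    (hD' : ∀ j, HasMaj (BlockNorm.ofBlocks g (liftBlk (blk ∘ π) ι)) (BlockNorm.ofBlocks g (liftBlk (blk ∘ π) ι)) (D' j) (fun y y' => β * Real.exp (-(δ * g.dist y y'))))
    (hDG : HasMaj (BlockNorm.ofBlocks g (liftBlk blk ι)) (BlockNorm.ofBlocks g (liftBlk (blk ∘ π) ι)) (idef (pull (liftMap π ι)) (pull (liftMap π ι)) G₀' G₀)
      (fun y y' => mG * Real.exp (-(δ * g.dist y y'))))
    (hDD : ∀ j, HasMaj (BlockNorm.ofBlocks g (liftBlk blk ι)) (BlockNorm.ofBlocks g (liftBlk (blk ∘ π) ι)) (idef (pull (liftMap π ι)) (pull (liftMap π ι)) (D' j) (D j))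
      (fun y y' => mG * Real.exp (-(δ * g.dist y y'))))
    (hV : HasMaj (BlockNorm.ofBlocks g (blkPair (liftBlk blk ι))) (BlockNorm.ofBlocks g (liftBlk blk ι)) V (fun y y' => R * Real.exp (-(δV * g.dist y y'))))
    (hV' : HasMaj (BlockNorm.ofBlocks g (blkPair (liftBlk (blk ∘ π) ι))) (BlockNorm.ofBlocks g (liftBlk (blk ∘ π) ι)) V' (fun y y' => R * Real.exp (-(δV * g.dist y y'))))
    (hDV : HasMaj (BlockNorm.ofBlocks g (blkPair (liftBlk blk ι))) (BlockNorm.ofBlocks g (liftBlk (blk ∘ π) ι))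
      (idef (pull (liftPair (liftMap π ι))) (pull (liftMap π ι)) V' V) (fun y y' => o * Real.exp (-(δV * g.dist y y'))))
    (hq : β * (R * cr) * cr < 1)
    (hDW : HasMaj (BlockNorm.ofBlocks g (liftBlk blk ι)) (BlockNorm.ofBlocks g (liftBlk (blk ∘ π) ι))
      (idef (pull (liftMap π ι)) (pull (liftMap π ι)) (commOp W' h' ∘ₗ (projO none ∘ₗ bgPropV (stack G₀' D') V')) (commOp W h ∘ₗ (projO none ∘ₗ bgPropV (stack G₀ D) V)))
      (fun y y' => ind S y * ind S y' * (rW * Real.exp (-(ρ₂ * g.dist y y'))))) :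
    HasMaj (BlockNorm.ofBlocks g (liftBlk blk ι)) (BlockNorm.ofBlocks g (liftBlk (blk ∘ π) ι))
      (idef (pull (liftMap π ι)) (pull (liftMap π ι)) (commOp (lapOp n' (fun μ => liftEquiv (τ' μ) ι) W') h' ∘ₗ (projO none ∘ₗ bgPropV (stack G₀' D') V'))
        (commOp (lapOp n (fun μ => liftEquiv (τ μ) ι) W) h ∘ₗ (projO none ∘ₗ bgPropV (stack G₀ D) V)))
      (fun y y' => ind S y * ind S y' * ((Fintype.card J *
          (c₂ * ((mG * cr + 1 * (mG * cr) * (R * (β * (1 - β * (R * cr) * cr)⁻¹) * cr) + β * o * cr * (β * (1 - β * (R * cr) * cr)⁻¹) * cr) * (1 - 1 * (β * (R * cr) * cr))⁻¹)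
            + o₂ * (β * (1 - β * (R * cr) * cr)⁻¹)
            + 2 * (c₁ * ((mG * cr + 1 * (mG * cr) * (R * (β * (1 - β * (R * cr) * cr)⁻¹) * cr) + β * o * cr * (β * (1 - β * (R * cr) * cr)⁻¹) * cr) * (1 - 1 * (β * (R * cr) * cr))⁻¹)
              + o₁ * (β * (1 - β * (R * cr) * cr)⁻¹))) + rW) * Real.exp (-(ρ₂ * g.dist y y')))) := by
  obtain ⟨hunit, -⟩ := hasMaj_dressedV_pair blk htri hd hrow hσ hβ hR hcr hσρ hρ₁V hρ₁G hρ₂ hρ₂₁ hG hD hV hq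
  obtain ⟨hunit', -⟩ := hasMaj_dressedV_pair (blk ∘ π) htri hd hrow hσ hβ hR hcr hσρ hρ₁V hρ₁G hρ₂ hρ₂₁ hG' hD' hV' hq
  -- coarse two-sided entries (files 23∕25)
  have hG0 := hasMaj_dressedV_loc₂ blk htri hd hrow hσ hβ hR hcr hσρ hρ₁V hρ₁G hρ₂ hρ₂₁ hSχ hSψ hGχ hGψ hDq hG hD hV hq
  have hcomp : ∀ j : J ⊕ J, HasMaj (BlockNorm.ofBlocks g (liftBlk blk ι)) (BlockNorm.ofBlocks g (liftBlk blk ι)) (Dq j ∘ₗ (projO none ∘ₗ bgPropV (stack G₀ D) V))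
      (fun y y' => ind S y * ind S y' * (β * (1 - β * (R * cr) * cr)⁻¹ * Real.exp (-(ρ₂ * g.dist y y')))) := fun j => by
    have hψ' : mulOp (fun p : X × ι => χX p.1) ∘ₗ (projO (some j) ∘ₗ stack G₀ D) = projO (some j) ∘ₗ stack G₀ D := by
      rw [projO_some_comp_stack]; exact hDχ j
    have key := hasMaj_projO_dressedV_loc₂ blk htri hd hrow hσ hβ hR hcr hσρ hρ₁V hρ₁G hρ₂ hρ₂₁ hDq (some j) hSχ hSψ hψ' hGψ hG hD hV hq
    rwa [projO_some_dressedV hDq hunit j] at key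
  -- two-sided defects of every component (file 25), read through `projO_some_dressedV` at both grids
  have hψ0 : mulOp (fun p : X × ι => χX p.1) ∘ₗ (projO none ∘ₗ stack G₀ D) = projO none ∘ₗ stack G₀ D := by
    rw [projO_none_comp_stack]; exact hGχ
  have hψ0' : mulOp (fun p : X' × ι => χX' p.1) ∘ₗ (projO none ∘ₗ stack G₀' D') = projO none ∘ₗ stack G₀' D' := by
    rw [projO_none_comp_stack]; exact hGχ'
  have hDG0 := hasMaj_idef_projO_dressedV_loc₂ blk π htri hd hrow hσ hcr hβ hR ho hmG hσρ hρ₁V hρ₁G hρ₂ hρ₂₁ hDq hDq' none hSχ hSψ hSχ' hSψ' hψ0 hGψ hψ0' hGψ' hG hD hG' hD'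
    hDG hDD hV hV' hDV hq
  have hDcomp : ∀ j : J ⊕ J, HasMaj (BlockNorm.ofBlocks g (liftBlk blk ι)) (BlockNorm.ofBlocks g (liftBlk (blk ∘ π) ι))
      (idef (pull (liftMap π ι)) (pull (liftMap π ι)) (Dq' j ∘ₗ (projO none ∘ₗ bgPropV (stack G₀' D') V')) (Dq j ∘ₗ (projO none ∘ₗ bgPropV (stack G₀ D) V)))
      (fun y y' => ind S y * ind S y' * ((mG * cr + 1 * (mG * cr) * (R * (β * (1 - β * (R * cr) * cr)⁻¹) * cr) + β * o * cr * (β * (1 - β * (R * cr) * cr)⁻¹) * cr) *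
        (1 - 1 * (β * (R * cr) * cr))⁻¹ * Real.exp (-(ρ₂ * g.dist y y')))) := fun j => by
    have hψj : mulOp (fun p : X × ι => χX p.1) ∘ₗ (projO (some j) ∘ₗ stack G₀ D) = projO (some j) ∘ₗ stack G₀ D := by
      rw [projO_some_comp_stack]; exact hDχ j
    have hψj' : mulOp (fun p : X' × ι => χX' p.1) ∘ₗ (projO (some j) ∘ₗ stack G₀' D') = projO (some j) ∘ₗ stack G₀' D' := by
      rw [projO_some_comp_stack]; exact hDχ' j
    have key := hasMaj_idef_projO_dressedV_loc₂ blk π htri hd hrow hσ hcr hβ hR ho hmG hσρ hρ₁V hρ₁G hρ₂ hρ₂₁ hDq hDq' (some j) hSχ hSψ hSχ' hSψ' hψj hGψ hψj' hGψ' hG hD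
      hG' hD' hDG hDD hV hV' hDV hq
    rwa [projO_some_dressedV hDq hunit j, projO_some_dressedV hDq' hunit' j] at key
  have hDf : ∀ μ, HasMaj (BlockNorm.ofBlocks g (liftBlk blk ι)) (BlockNorm.ofBlocks g (liftBlk blk ι)) (fgrad n (liftEquiv (τ μ) ι) ∘ₗ (projO none ∘ₗ bgPropV (stack G₀ D) V))
      (fun y y' => ind S y * ind S y' * (β * (1 - β * (R * cr) * cr)⁻¹ * Real.exp (-(ρ₂ * g.dist y y')))) := fun μ => by
    simpa only [hDqf] using hcomp (Sum.inl μ)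
  have hDb : ∀ μ, HasMaj (BlockNorm.ofBlocks g (liftBlk blk ι)) (BlockNorm.ofBlocks g (liftBlk blk ι)) (bgrad n (liftEquiv (τ μ) ι) ∘ₗ (projO none ∘ₗ bgPropV (stack G₀ D) V))
      (fun y y' => ind S y * ind S y' * (β * (1 - β * (R * cr) * cr)⁻¹ * Real.exp (-(ρ₂ * g.dist y y')))) := fun μ => by
    simpa only [hDqb] using hcomp (Sum.inr μ)
  have hDDf : ∀ μ, HasMaj (BlockNorm.ofBlocks g (liftBlk blk ι)) (BlockNorm.ofBlocks g (liftBlk (blk ∘ π) ι))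
      (idef (pull (liftMap π ι)) (pull (liftMap π ι)) (fgrad n' (liftEquiv (τ' μ) ι) ∘ₗ (projO none ∘ₗ bgPropV (stack G₀' D') V'))
        (fgrad n (liftEquiv (τ μ) ι) ∘ₗ (projO none ∘ₗ bgPropV (stack G₀ D) V)))
      (fun y y' => ind S y * ind S y' * ((mG * cr + 1 * (mG * cr) * (R * (β * (1 - β * (R * cr) * cr)⁻¹) * cr) + β * o * cr * (β * (1 - β * (R * cr) * cr)⁻¹) * cr) *
        (1 - 1 * (β * (R * cr) * cr))⁻¹ * Real.exp (-(ρ₂ * g.dist y y')))) := fun μ => by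
    simpa only [hDqf, hDqf'] using hDcomp (Sum.inl μ)
  have hDDb : ∀ μ, HasMaj (BlockNorm.ofBlocks g (liftBlk blk ι)) (BlockNorm.ofBlocks g (liftBlk (blk ∘ π) ι))
      (idef (pull (liftMap π ι)) (pull (liftMap π ι)) (bgrad n' (liftEquiv (τ' μ) ι) ∘ₗ (projO none ∘ₗ bgPropV (stack G₀' D') V'))
        (bgrad n (liftEquiv (τ μ) ι) ∘ₗ (projO none ∘ₗ bgPropV (stack G₀ D) V)))
      (fun y y' => ind S y * ind S y' * ((mG * cr + 1 * (mG * cr) * (R * (β * (1 - β * (R * cr) * cr)⁻¹) * cr) + β * o * cr * (β * (1 - β * (R * cr) * cr)⁻¹) * cr) *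
        (1 - 1 * (β * (R * cr) * cr))⁻¹ * Real.exp (-(ρ₂ * g.dist y y')))) := fun μ => by
    simpa only [hDqb, hDqb'] using hDcomp (Sum.inr μ)
  exact hasMaj_idef_commOp_lapOp_comp (liftBlk blk ι) (liftMap π ι) hc₁ hc₂ ho₁ ho₂ hh1' hh1b' hh2' hf1 hf1b hf2 hG0 hDf hDb hDG0 hDDf hDDb hDW

end Flat

/-! ## §3 The nonlocal summand's defect row — a Leibniz split against FILE 56's letters (generic carrier) -/

section Nonlocal

variable {Y Y' : Type} [Fintype Y] [Fintype Y'] {g : B6.Geometry} (blkY : Y → g.Site) (πY : Y' → Y) {σ cr : ℝ}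

/-- ★ **THE η-DEFECT OF `[N, M_h]∘G`, INPUT-LOCALIZED**: `𝔇([N′,M_{h′}]∘G′, [N,M_h]∘G) = [N′,M_{h′}]∘𝔇(G′,G) + 𝔇([N′,M_{h′}],[N,M_h])∘G`; with the fine commutator letter `[N′, M_{h′}] ≤ c_Ne^{−ρ_Nd}`,
its defect letter `𝔇([N′,M_{h′}],[N,M_h]) ≤ r_Ne^{−ρ_Nd}` (dag-n15-c FILE 56 `hasMaj_commOp_nonlocal` ∕ `hasMaj_idef_commOp_nonlocal`), the cube's two-sided `G ≤ 1_S1_S·βe^{−δd}`, `𝔇(G′,G) ≤ 1_S1_S·me^{−δd}`,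
rates `0 ≤ ρ ≤ δ`, `ρ + σ ≤ ρ_N`: `≤ 1_S(y′)·(c_N·m·c_r + r_N·β·c_r)·e^{−ρd}` — the defect companion of FILE 57 `hasMaj_commOp_comp_of_add`'s nonlocal term.
[cite: Balaban1984PropagatorsI, (1.120)–(1.128) pp.37–38 (mechanism); Balaban1985BackgroundPropagators, Thm 3.14 pp.426–427 (difference template)] -/
theorem hasMaj_idef_commOp_comp_in (htri : Triangle254 g) (hd : ∀ a b : g.Site, 0 ≤ g.dist a b) (hrow : RowSum g σ cr) {N G : (Y → ℝ) →ₗ[ℝ] (Y → ℝ)} {N' G' : (Y' → ℝ) →ₗ[ℝ] (Y' → ℝ)}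
    {h : Y → ℝ} {h' : Y' → ℝ} {S : Set g.Site} {cN rN β m δ ρN ρ : ℝ} (hcN : 0 ≤ cN) (hrN : 0 ≤ rN) (hβ : 0 ≤ β) (hm : 0 ≤ m) (hρ : 0 ≤ ρ) (hρδ : ρ ≤ δ) (hρN : ρ + σ ≤ ρN)
    (hKN' : HasMaj (BlockNorm.ofBlocks g (blkY ∘ πY)) (BlockNorm.ofBlocks g (blkY ∘ πY)) (commOp N' h') (fun y y' => cN * Real.exp (-(ρN * g.dist y y'))))
    (hDKN : HasMaj (BlockNorm.ofBlocks g blkY) (BlockNorm.ofBlocks g (blkY ∘ πY)) (idef (pull πY) (pull πY) (commOp N' h') (commOp N h))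
      (fun y y' => rN * Real.exp (-(ρN * g.dist y y'))))
    (hG : HasMaj (BlockNorm.ofBlocks g blkY) (BlockNorm.ofBlocks g blkY) G (fun y y' => ind S y * ind S y' * (β * Real.exp (-(δ * g.dist y y')))))
    (hDG : HasMaj (BlockNorm.ofBlocks g blkY) (BlockNorm.ofBlocks g (blkY ∘ πY)) (idef (pull πY) (pull πY) G' G) (fun y y' => ind S y * ind S y' * (m * Real.exp (-(δ * g.dist y y'))))) :
    HasMaj (BlockNorm.ofBlocks g blkY) (BlockNorm.ofBlocks g (blkY ∘ πY)) (idef (pull πY) (pull πY) (commOp N' h' ∘ₗ G') (commOp N h ∘ₗ G))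
      (fun y y' => ind S y' * ((cN * m * cr + rN * β * cr) * Real.exp (-(ρ * g.dist y y')))) := by
  rw [idef_comp (pull πY) (pull πY) (pull πY)]
  have t1 := hasMaj_comp_exp_in (blkY ∘ πY) htri hd hrow hcN hm hρ hρδ hρN hKN' hDG
  have t2 := hasMaj_comp_exp_in blkY htri hd hrow hrN hβ hρ hρδ hρN hDKN hG
  refine (t1.add t2).mono fun y y' => le_of_eq ?_
  ring

end Nonlocal

end Summit.QuantumFields.YangMills.BalabanUVNodes.N15.CurvedSpecies

end
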